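import Summits.Ventures.HSemireg.ComponentTransfer
import Literature.AlgebraicGeometry.HodgeTheory.BlochSemiregularSpreadGlobal
import Literature.AlgebraicGeometry.ModuliOfAbelianVarieties.HodgeLociCMPoints
import HarnessLib

/-!
# Venture HSemireg — the transfer chain on the universal family of abelian varieties: the chart ASSUMPTION for
# `𝒜_{g,δ,N}` (assembled from CDK 1995, Moonen 1998, Hironaka 1964, Deligne 1971) and the 𝒜_g-form of
# «semiregular at one point of a Hodge-locus component ⟹ the class is algebraic on every member of the component»

HONEST FRAMING. Assembly file of the computation cell `pub-hsemireg` (theory seat 3); nothing is claimed about any variety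
and nothing here says that HC / HC_CM / HC_AV holds. `ComponentTransfer.lean` proves the transfer for an ARBITRARY family
`g : 𝒴 ⟶ M` with the algebraic chart of the component as the RAW hypothesis `SweepsClasses g f W C.carrier` (red team,
RED-1 v2 V2-T1: «instantiation gap, not vacuity»). This file closes the gap in the only way the literature allows — by
NAMING the chart as ONE assumption for the universal family `D.f : D.𝒳 ⟶ D.S` of a Siegel fine moduli datum
`D : SiegelModuliDatum g δ N` (`Γ_δ(N)∖𝔥_g` with its universal family, `SiegelModuliDatum.lean`) — an ASSEMBLED statement,
NOT printed as one sentence anywhere (theory seat 2, TH2-CHAIN-ARROWS §2bis, declined to vendor it as a Literature fact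
for exactly that reason), whose printed ingredients are:

 (i)  Cattani–Deligne–Kaplan 1995, Thm. 1.1 / Cor. 1.2–1.3: the locus of Hodge classes `S^{(K)}` is an algebraic variety,
      finite over the base; a connected component `C` of the locus of Hodge classes of `D.f` is a union of components of
      some `S^{(K)}` (tree: `cattaniDeligneKaplan1995_hodgeLocusComponent_base_isZariskiClosed`, the base only);
 (ii) Moonen 1998 (Linearity I, 2.4) / Moonen–Oort 2013 §3: `HL(𝔥_g; t) = Y_{Stab(t)}` is a finite DISJOINT union of closed
      `Stab(t)(ℝ)⁺`-orbits, so a connected component of the locus of Hodge classes of the universal family has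
      IRREDUCIBLE carrier (theory seat 2, TH2-CHAIN-ARROWS §2bis (ii); Carlson–Müller-Stach–Peters Prop. 17.1.2);
 (iii) Hironaka 1964, Main Thm. I: a resolution `T → C_red` — smooth, irreducible, quasi-projective — and the pull-back
      `𝒳 := D.𝒳 ×_{D.S} T → T` of the universal family, with its projection `Φ : 𝒳 → D.𝒳` (fibres map isomorphically);
      for NEAT level (`N ≥ 3`, the range in which the datum exists: `mumford1965_siegelFineModuli`) no resolution is even
      needed: lifting `C` to `𝔥_g × ∧^{2p}V^∨_ℚ`, `C.carrier ≅ Γ'∖Y⁰` with `Y⁰` a connected component of `Y_{Stab(t)}` (a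
      connected complex submanifold of `𝔥_g`) and `Γ' = {γ ∈ Γ_δ(N) : γY⁰ = Y⁰, γt = t}` neat, acting freely — a connected
      complex manifold, finite over its image `C.base` (which CAN be singular: self-intersections where `γY⁰ ∩ Y⁰ ≠ ∅`,
      `γt ≠ t`; this is theory seat 2's flag F-1, and the reason the chart is `C.carrier`, not `C.base`);
 (iv) Deligne, *Théorie de Hodge II*, Thm. 4.1.1 (= Charles–Schnell Thm. 11.3.4; tree named fact
      `deligne_globalInvariantCycles`): the tautological class `u ↦ α_{ρ(u)}` is a continuous global section of the étalé
      space of `R²ᵖ(f_T)_*ℂ` over `T(ℂ)`, hence monodromy-invariant, hence the restriction of a GLOBAL class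
      `W ∈ H²ᵖ(𝒳(ℂ); ℂ)`; it is fibrewise rational of type `(p,p)` because every point of `T` maps to a Hodge class.

* `SiegelHodgeLocusChart g δ N` (ASSUMPTION A-chart, `def … : Prop`): every component `C` of the locus of Hodge classes
  (degree `2p`) of every Siegel datum `D` is swept by such a chart `(𝒳, T, f, Φ, W)`: `f` smooth projective of relative
  dimension `g`, `𝒳`, `T` quasi-projective, `T` smooth irreducible, `W` fibrewise rational `(p,p)`, EVERY fibre of `f`
  identified with a fibre of `D.f` compatibly with `Φ`, and every `(t, α) ∈ C` reached: `e^* α = W|_{𝒳_u}` for some `u`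
  and some `Φ`-compatible `e : 𝒳_u ≅ 𝒴_t`.
* `SiegelHodgeLocusChart.sweepsClasses` — the assumption yields `SweepsClasses D.f f W C.carrier` (PROVED, unfolding).
* `hc_on_siegelComponent_of_semiregular` — **the 𝒜_g-form of the chain**: `SiegelHodgeLocusChart g δ N` ∧
  `BlochSemiregularSpread g p` ∧ ONE point `(t₀, α₀) ∈ C` with an integral Bloch-semiregular lci `Z ↪ 𝒴_{t₀}` of
  codimension `p` supporting `α₀` ⟹ `α` algebraic for EVERY `(t, α) ∈ C` (PROVED: chart ⟹ `ComponentTransfer`).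
* `hc_on_siegelComponent_of_semiregular_of_smul_add` — **Bloch's Remark (7.5) / the cell's `q·hⁿ + w` form**, the one that
  is NOT vacuous for PRIMITIVE classes such as Weil classes (RED-1 v2 V2-T2: a non-zero `h`-primitive class is never
  supported on one integral `Z`): the lci `Z ↪ 𝒴_{t₀}` supports `a·α₀ + b·Λ|_{𝒴_{t₀}}`, `a, b ∈ ℚ`, `a ≠ 0`, for a GLOBAL
  class `Λ` of the universal family that is fibrewise rational `(p,p)` AND fibrewise algebraic (the `p`-th power of the
  relative polarisation) ⟹ `α` algebraic for every `(t, α) ∈ C` (PROVED: pull `Λ` back along `Φ`, apply the global form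
  of `BlochSemiregularSpread` to `a·W + b·Φ^*Λ` on the chart, subtract, sweep).
* `exists_cmPoint_of_component` — pointer: by theory seat 2's fact `siegelModuli_hodgeLocusComponent_cmLocus_dense`
  every such component HAS a CM point, so the one semiregularity check may be placed at a CM point (where explicit
  representatives exist); CM-ness is otherwise NOT used by the deduction.

NOT inputs: HC_CM, CM density (except in the pointer), André–Oort, finiteness of Mumford–Tate types
(`theory/TH3-MT-FINITENESS.md`: unused and, over `ℚ`, false). Scope: lci SUBSCHEME representatives (Bloch); sheaf and
reducible-lci doors: `ComponentTransferSheaf.lean`, `ComponentTransferSubscheme.lean`.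

References: [CattaniDeligneKaplan1995JAMS] Thm. 1.1, Cor. 1.2–1.3; [Moonen1998LinearityI] 2.4; [MoonenOort2013Torelli] §3;
[Hironaka1964] Main Thm. I; [DeligneHodgeII1971] Thm. 4.1.1; [CharlesSchnell2014Notes] Thm. 11.3.4, Thm. 11.5.10;
[CarlsonMullerStachPeters2017] Prop. 17.1.2, Cor. 17.1.5; [Bloch1972Semiregularity] (7.4), (7.5) p. 65;
[BuchweitzFlenner2003] Thm. 5.2.
-/

noncomputable section

open CategoryTheory AlgebraicGeometry Set
open Literature.AlgebraicGeometry.Motives Literature.AlgebraicGeometry.HodgeTheory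
open Literature.AlgebraicGeometry.ModuliOfAbelianVarieties Literature.AlgebraicGeometry.Deligne1982

namespace Summit.Ventures.HSemireg

local notation3 (prettyPrint := false) "Res[" f ", " s ", " k ", " A "]" =>
  complexBetti.map (Literature.AlgebraicGeometry.Motives.fiberι f s) k A

/-! ## The chart assumption for the universal family -/

/-- **ASSUMPTION A-chart (assembled, NOT printed as one statement): every component of the locus of Hodge classes of the
universal family of abelian varieties is swept by a smooth irreducible algebraic chart carrying the class globally.** For
every Siegel fine moduli datum `D : SiegelModuliDatum g δ N` (universal family `D.f : D.𝒳 ⟶ D.S` over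
`D.S(ℂ) ≃ Γ_δ(N)∖𝔥_g`), every `p` and every connected component `C` of the locus of Hodge classes of `D.f` in degree `2p`,
there are a smooth projective family `f : 𝒳 ⟶ T` of relative dimension `g` with `𝒳`, `T` quasi-projective and `T` SMOOTH
and IRREDUCIBLE, a morphism `Φ : 𝒳 ⟶ D.𝒳` mapping every fibre of `f` isomorphically onto a fibre of `D.f`, and a GLOBAL
class `W ∈ H²ᵖ(𝒳(ℂ); ℂ)` fibrewise rational of type `(p,p)`, such that every `(t, α) ∈ C` is `e^* α = W|_{𝒳_u}` for some
`u ∈ T(ℂ)` and some `Φ`-compatible isomorphism `e : 𝒳_u ≅ 𝒴_t`. ASSEMBLY (module docstring (i)–(iv)): `T` = a resolution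
(Hironaka) of the reduced component, which is an irreducible (Moonen 1998, 2.4: `HL(𝔥_g;t)` is a finite disjoint union of
closed orbits) algebraic variety finite over `D.S` (Cattani–Deligne–Kaplan 1995, Thm. 1.1); `𝒳 = D.𝒳 ×_{D.S} T`, `Φ` the
projection; `W` = the tautological class, global by Deligne's théorème de la partie fixe (Hodge II, 4.1.1). The SHAPE is
printed — Voisin 2007, proof of Lemma 2.4: «`S̃_α` … algebraic [CDK] … base change `S̃_{α,red} → T` … `π_α` admits the locally
constant section `α̃ ∈ H⁰(S̃_{α,red}, R^{2k}π_{α*}ℚ)`; by the global invariant cycle theorem there exists `β ∈ H^{2k}(𝒳̄_α, ℚ)`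
of type `(k,k)` restricting to `α̃_t` on each fiber», and §3, proof of the Proposition: «smooth irreducible quasi-projective
`𝒳, T`, a projective morphism `π : 𝒳 → T`, and a locally constant global section `α̃ ∈ H⁰(T, R^{2k}π_*ℚ)` … `β|_X = α`» —
but Voisin shrinks to a Zariski open of the smooth part («`t ∈ S′` generic»); keeping a GIVEN special point inside a SMOOTH
chart needs the resolution (or, at neat level, the smoothness of `C.carrier` above) — that one step is ASSEMBLED, not
printed, so the whole is recorded as an assumption and the 𝒜_g-form of the chain below carries it BY NAME. Intended range:
`N ≥ 3` (neat level; the parameters `g, δ, N` are those of the datum).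
[cite: Voisin2007HodgeLoci, proof of Lemma 2.4 and §3 proof of Prop. (arXiv math/0605766 p. 5 L16–27, p. 6)]
[cite: CattaniDeligneKaplan1995JAMS, Thm. 1.1 and Cor. 1.2–1.3] [cite: Moonen1998LinearityI, 2.4]
[cite: MoonenOort2013Torelli, §3] [cite: Hironaka1964, Main Theorem I] [cite: DeligneHodgeII1971, Théorème 4.1.1]
[cite: CharlesSchnell2014Notes, Thm. 11.3.4] [cite: CarlsonMullerStachPeters2017, Prop. 17.1.2] -/
def SiegelHodgeLocusChart (g : ℕ) (δ : Fin g → ℕ) (N : ℕ) : Prop :=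
  ∀ (D : SiegelModuliDatum g δ N) (p : ℕ) (C : HodgeLocusComponent D.f g p),
    ∃ (𝒳 T : SchemeOver ℂ) (f : 𝒳 ⟶ T) (Φ : 𝒳 ⟶ D.𝒳) (W : complexBetti 𝒳 (2 * p)),
      IsSmoothProjectiveFamily f g ∧ IsQuasiProjectiveOver 𝒳 ∧ IsQuasiProjectiveOver T ∧
      _root_.AlgebraicGeometry.Smooth T.hom ∧ IrreducibleSpace T.left ∧
      (∀ u : ComplexPoints T, IsRationalClass (Res[f, u, 2 * p, W]) ∧
        IsOfHodgeType g (fiberOver f u) (2 * p) p p (Res[f, u, 2 * p, W])) ∧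
      (∀ u : ComplexPoints T, ∃ (s : ComplexPoints D.S) (e : fiberOver f u ≅ fiberOver D.f s),
        e.hom ≫ fiberι D.f s = fiberι f u ≫ Φ) ∧
      (∀ x ∈ C.carrier, ∃ (u : ComplexPoints T) (e : fiberOver f u ≅ fiberOver D.f x.pt),
        e.hom ≫ fiberι D.f x.pt = fiberι f u ≫ Φ ∧ complexBetti.map e.hom (2 * p) x.cls = Res[f, u, 2 * p, W])

section Consequences

variable {g : ℕ} {δ : Fin g → ℕ} {N : ℕ}

/-- A `Φ`-compatible fibre identification transports restrictions of global classes of the universal family to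
restrictions of their pull-backs: `e^*(Λ|_{𝒴_s}) = (Φ^*Λ)|_{𝒳_u}` (functoriality of `H^k(–(ℂ); ℂ)`).
[cite: FultonYoungTableaux1997, Appendix B §B.1 (1)] -/
theorem map_res_eq_res_map_of_comm {D : SiegelModuliDatum g δ N} {𝒳 T : SchemeOver ℂ} {f : 𝒳 ⟶ T}
    {Φ : 𝒳 ⟶ D.𝒳} {u : ComplexPoints T} {s : ComplexPoints D.S} (e : fiberOver f u ≅ fiberOver D.f s)
    (he : e.hom ≫ fiberι D.f s = fiberι f u ≫ Φ) (k : ℕ) (Λ : complexBetti D.𝒳 k) :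
    complexBetti.map e.hom k (Res[D.f, s, k, Λ]) = Res[f, u, k, complexBetti.map Φ k Λ] := by
  change (complexBetti.map (fiberι D.f s) k ≫ complexBetti.map e.hom k) Λ =
    (complexBetti.map Φ k ≫ complexBetti.map (fiberι f u) k) Λ
  rw [← complexBetti.map_comp, ← complexBetti.map_comp, he]

/-- The chart assumption yields the chart hypothesis `SweepsClasses` of `ComponentTransfer.lean` (forget `Φ`).
[cite: CattaniDeligneKaplan1995JAMS, Thm. 1.1 and Cor. 1.2] -/
theorem SiegelHodgeLocusChart.exists_sweepsClasses (hA : SiegelHodgeLocusChart g δ N) (D : SiegelModuliDatum g δ N)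
    (p : ℕ) (C : HodgeLocusComponent D.f g p) :
    ∃ (𝒳 T : SchemeOver ℂ) (f : 𝒳 ⟶ T) (Φ : 𝒳 ⟶ D.𝒳) (W : complexBetti 𝒳 (2 * p)),
      IsSmoothProjectiveFamily f g ∧ IsQuasiProjectiveOver 𝒳 ∧ IsQuasiProjectiveOver T ∧
      _root_.AlgebraicGeometry.Smooth T.hom ∧ IrreducibleSpace T.left ∧
      (∀ u : ComplexPoints T, IsRationalClass (Res[f, u, 2 * p, W]) ∧
        IsOfHodgeType g (fiberOver f u) (2 * p) p p (Res[f, u, 2 * p, W])) ∧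
      (∀ u : ComplexPoints T, ∃ (s : ComplexPoints D.S) (e : fiberOver f u ≅ fiberOver D.f s),
        e.hom ≫ fiberι D.f s = fiberι f u ≫ Φ) ∧
      SweepsClasses D.f f W C.carrier := by
  obtain ⟨𝒳, T, f, Φ, W, hf, h𝒳, hT, hTs, hTi, hW, hΦ, hsw⟩ := hA D p C
  exact ⟨𝒳, T, f, Φ, W, hf, h𝒳, hT, hTs, hTi, hW, hΦ, fun x hx => by
    obtain ⟨u, e, -, he⟩ := hsw x hx
    exact ⟨u, e, he⟩⟩

/-- **The transfer chain on 𝒜_{g,δ,N} — plain form.** Granted the chart assumption `SiegelHodgeLocusChart g δ N` and the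
named fact `BlochSemiregularSpread g p` (Bloch 1972 (7.4) / BF 2003 Thm. 5.2): for every component `C` of the locus of
Hodge classes of the universal family and ONE point `(t₀, α₀) ∈ C` at which `α₀` is SUPPORTED on an integral
Bloch-semiregular local complete intersection `Z ↪ 𝒴_{t₀}` of codimension `p`, the class `α` is algebraic for EVERY
`(t, α) ∈ C`. (For `h`-primitive classes — e.g. Weil classes — use the `_of_smul_add` form: a non-zero primitive class is
never supported on one integral `Z`.) [cite: Bloch1972Semiregularity, Thm. (7.4), p. 65] [cite: BuchweitzFlenner2003, Thm. 5.2]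
[cite: CattaniDeligneKaplan1995JAMS, Thm. 1.1 and Cor. 1.2] -/
theorem hc_on_siegelComponent_of_semiregular (hA : SiegelHodgeLocusChart g δ N) {p : ℕ}
    (hB : BlochSemiregularSpread g p) (D : SiegelModuliDatum g δ N) (C : HodgeLocusComponent D.f g p)
    {x₀ : FiberClass D.f (2 * p)} (hx₀ : x₀ ∈ C.carrier)
    {Z : Scheme.{0}} (i : Z ⟶ (fiberOver D.f x₀.pt).left) (hi : IsClosedImmersion i)
    (hreg : IsRegularImmersionOfCodim i p) (hZ : AlgebraicGeometry.IsIntegral Z)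
    (hcodim : ∀ z ∈ Set.range i.base, (p : ℕ∞) ≤ Order.coheight z) (hsr : IsBlochSemiregular i g p)
    (hsupp : x₀.cls ∈ classesSupportedOn (fiberOver D.f x₀.pt) (Set.range i.base) (2 * p)) :
    ∀ x ∈ C.carrier, x.cls ∈ algebraicClasses (fiberOver D.f x.pt) p := by
  obtain ⟨𝒳, T, f, Φ, W, hf, h𝒳, hT, hTs, hTi, hW, -, hsweep⟩ := hA.exists_sweepsClasses D p C
  haveI := hTi
  exact hc_on_component_of_semiregular_at_CM_point hB C hf h𝒳 hT hTs hW hsweep hx₀ i hi hreg hZ hcodim hsr hsupp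

/-- **The transfer chain on 𝒜_{g,δ,N} — Bloch's Remark (7.5) form (the cell's `q·hⁿ + w`).** Granted
`SiegelHodgeLocusChart g δ N` and `BlochSemiregularSpread g p`: let `Λ ∈ H²ᵖ(D.𝒳(ℂ); ℂ)` be a global class of the universal
family that is fibrewise rational of type `(p,p)` AND fibrewise algebraic (the `p`-th power of the relative polarisation
class), `C` a component of the locus of Hodge classes, `(t₀, α₀) ∈ C`, and `Z ↪ 𝒴_{t₀}` an integral Bloch-semiregular local
complete intersection of codimension `p` supporting `a·α₀ + b·Λ|_{𝒴_{t₀}}` with `a, b ∈ ℚ`, `a ≠ 0` («there exist integers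
`a, b`, `a ≠ 0`, such that `a z₀ + b l₀ᵖ` is the class of a subscheme `Z₀ ⊂ X₀` which is semi-regular and a local complete
intersection»). Then `α` is algebraic for EVERY `(t, α) ∈ C`. Proof: on the chart, `V := a·W + b·Φ^*Λ` is a global class,
fibrewise rational `(p,p)`, with `e₀^*`-value at `u₀` the supported class; the global form of `BlochSemiregularSpread`
(with the tree's proof of the algebraicity-locus fact) makes `V` algebraic on every fibre of the chart; `Φ^*Λ` is algebraic
on every fibre (each is a fibre of `D.f`); hence so is `W`; sweep.
[cite: Bloch1972Semiregularity, Thm. (7.4) and Remark (7.5), p. 65] [cite: BuchweitzFlenner2003, Thm. 5.2]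
[cite: CattaniDeligneKaplan1995JAMS, Thm. 1.1 and Cor. 1.2] [cite: DeligneHodgeII1971, Théorème 4.1.1] -/
theorem hc_on_siegelComponent_of_semiregular_of_smul_add (hA : SiegelHodgeLocusChart g δ N) {p : ℕ}
    (hB : BlochSemiregularSpread g p) (D : SiegelModuliDatum g δ N) (C : HodgeLocusComponent D.f g p)
    (Λ : complexBetti D.𝒳 (2 * p))
    (hΛ : ∀ s : ComplexPoints D.S, IsRationalClass (Res[D.f, s, 2 * p, Λ]) ∧
      IsOfHodgeType g (fiberOver D.f s) (2 * p) p p (Res[D.f, s, 2 * p, Λ]))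
    (hΛalg : ∀ s : ComplexPoints D.S, Res[D.f, s, 2 * p, Λ] ∈ algebraicClasses (fiberOver D.f s) p)
    {x₀ : FiberClass D.f (2 * p)} (hx₀ : x₀ ∈ C.carrier) (a b : ℚ) (ha : a ≠ 0)
    {Z : Scheme.{0}} (i : Z ⟶ (fiberOver D.f x₀.pt).left) (hi : IsClosedImmersion i)
    (hreg : IsRegularImmersionOfCodim i p) (hZ : AlgebraicGeometry.IsIntegral Z)
    (hcodim : ∀ z ∈ Set.range i.base, (p : ℕ∞) ≤ Order.coheight z) (hsr : IsBlochSemiregular i g p)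
    (hsupp : (a : ℂ) • x₀.cls + (b : ℂ) • Res[D.f, x₀.pt, 2 * p, Λ] ∈
      classesSupportedOn (fiberOver D.f x₀.pt) (Set.range i.base) (2 * p)) :
    ∀ x ∈ C.carrier, x.cls ∈ algebraicClasses (fiberOver D.f x.pt) p := by
  obtain ⟨𝒳, T, f, Φ, W, hf, h𝒳, hT, hTs, hTi, hW, hΦ, hsw⟩ := hA D p C
  haveI := hTi
  -- the pulled-back class `L = Φ^*Λ` and its fibrewise properties (every chart fibre is a fibre of `D.f`)
  set L : complexBetti 𝒳 (2 * p) := complexBetti.map Φ (2 * p) Λ with hLdef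
  have hLfib : ∀ u : ComplexPoints T, (IsRationalClass (Res[f, u, 2 * p, L]) ∧
      IsOfHodgeType g (fiberOver f u) (2 * p) p p (Res[f, u, 2 * p, L])) ∧
      Res[f, u, 2 * p, L] ∈ algebraicClasses (fiberOver f u) p := by
    intro u
    obtain ⟨s, e, he⟩ := hΦ u
    have hres : Res[f, u, 2 * p, L] = complexBetti.map e.hom (2 * p) (Res[D.f, s, 2 * p, Λ]) := by
      rw [hLdef, map_res_eq_res_map_of_comm e he]
    rw [hres]
    exact ⟨⟨(isRationalClass_map_iff_of_iso e).2 (hΛ s).1, (isOfHodgeType_map_iff_of_iso e).2 (hΛ s).2⟩,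
      (mem_algebraicClasses_map_iff_of_iso e).2 (hΛalg s)⟩
  -- the special point on the chart and the combined global class `V = a·W + b·L`
  obtain ⟨u₀, e₀, he₀Φ, he₀⟩ := hsw x₀ hx₀
  have hVres : ∀ u : ComplexPoints T, Res[f, u, 2 * p, (a : ℂ) • W + (b : ℂ) • L] =
      (a : ℂ) • Res[f, u, 2 * p, W] + (b : ℂ) • Res[f, u, 2 * p, L] := fun u => by
    simp only [map_add, map_smul]
  have hVhodge : ∀ u : ComplexPoints T, IsRationalClass (Res[f, u, 2 * p, (a : ℂ) • W + (b : ℂ) • L]) ∧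
      IsOfHodgeType g (fiberOver f u) (2 * p) p p (Res[f, u, 2 * p, (a : ℂ) • W + (b : ℂ) • L]) := fun u => by
    rw [hVres u]
    exact ⟨((hW u).1.smul a).add ((hLfib u).1.1.smul b),
      ((hW u).2.smul (a : ℂ)).add (hf.isSmoothProjective u) ((hLfib u).1.2.smul (b : ℂ))⟩
  have hVx : complexBetti.map e₀.symm.hom (2 * p) (Res[f, u₀, 2 * p, (a : ℂ) • W + (b : ℂ) • L]) =
      (a : ℂ) • x₀.cls + (b : ℂ) • Res[D.f, x₀.pt, 2 * p, Λ] := by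
    rw [hVres u₀, ← he₀, hLdef, ← map_res_eq_res_map_of_comm e₀ he₀Φ, Iso.symm_hom, map_add, map_smul, map_smul,
      e₀.complexBetti_map_inv_map_hom, e₀.complexBetti_map_inv_map_hom]
  have hVall : ∀ u : ComplexPoints T,
      Res[f, u, 2 * p, (a : ℂ) • W + (b : ℂ) • L] ∈ algebraicClasses (fiberOver f u) p :=
    hB.forall_mem_algebraicClasses charlesSchnell_algebraicityLocus_iUnion_closed_holds (fiberOver D.f x₀.pt) Z i _
      f u₀ e₀.symm ((a : ℂ) • W + (b : ℂ) • L) hi hreg hZ hcodim hsr hsupp hf h𝒳 hT hTs hVhodge hVx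
  have ha' : (a : ℂ) ≠ 0 := by exact_mod_cast ha
  have hWalg : ∀ u : ComplexPoints T, Res[f, u, 2 * p, W] ∈ algebraicClasses (fiberOver f u) p := by
    intro u
    have h1 : (a : ℂ) • Res[f, u, 2 * p, W] ∈ algebraicClasses (fiberOver f u) p := by
      have := Submodule.sub_mem _ (hVall u) (Submodule.smul_mem _ (b : ℂ) (hLfib u).2)
      rwa [hVres u, add_sub_cancel_right] at this
    have h2 := Submodule.smul_mem _ (a : ℂ)⁻¹ h1
    rwa [smul_smul, inv_mul_cancel₀ ha', one_smul] at h2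
  have hsweep : SweepsClasses D.f f W C.carrier := fun x hx => by
    obtain ⟨u, e, -, he⟩ := hsw x hx
    exact ⟨u, e, he⟩
  exact fun x hx => hsweep.mem_algebraicClasses hWalg hx

/-- **Pointer: the one check may be placed at a CM point.** By theory seat 2's named fact (Carlson–Müller-Stach–Peters
Prop. 17.1.2 + Cor. 17.1.5; Moonen–Oort §3) every component of the locus of Hodge classes of the universal family has a
point over the CM locus — where the cell's explicit representatives live. CM-ness is NOT used by the two theorems above.
[cite: CarlsonMullerStachPeters2017, Prop. 17.1.2 and Cor. 17.1.5] [cite: MoonenOort2013Torelli, §3] -/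
theorem exists_cmPoint_of_component (h : siegelModuli_hodgeLocusComponent_cmLocus_dense) (D : SiegelModuliDatum g δ N)
    {p : ℕ} (C : HodgeLocusComponent D.f g p) :
    ∃ x ∈ C.carrier, x.pt ∈ cmLocus D.f g := by
  obtain ⟨t, ⟨x, hx, rfl⟩, ht⟩ := h.exists_mem_base_inter_cmLocus D C
  exact ⟨x, hx, ht⟩

end Consequences

end Summit.Ventures.HSemireg

end
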